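import Summits.HodgeConjecture.CorCM.TwoGroupHalfSubgroup
import Summits.HodgeConjecture.CorCM.TwoGroupInvertedCyclicEightTable
import Summits.HodgeConjecture.CorCM.TwoGroupCyclicIndexTwoUniqueInvolution
import HarnessLib

/-!
# An involution with exactly two conjugates (case A of the order-`32` base)

COR-CM (cell `pub-hodgecm2`), binder seat b04 (gen 37), count-neutral own lane «Galois-CM-type classification».  KERNEL ONLY:
theorems; no definition, no named fact, no `sorry`.  Pure group theory (A7-JUNCTION gen-36 addendum §F–§G «lemma SIZE2»,
gen-37 addendum).  `|G| = 32`, `c` the ONLY central involution, `g⁴ ∈ {1, c}` for all `g`, `a` of order `8` (so `a⁴ = c`), and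
some involution is not central.  Then there is an involution `t ∉ {1, c}` all of whose conjugates lie in `{t, tc}` and which is
conjugate to `tc` (`exists_involution_two_conjugates`): its centraliser has index `2`.  Anchor `a`:

* if some `m ∉ ⟨a⟩` commutes with `a` (and `a` is not central), `C(a) = ⟨a⟩ × ⟨m⟩` by counting, `m² = a^{2i'}`, and
  `t = m a^{-i'}` is an involution commuting with `a` — two conjugates by `CaseA.conj_involution_of_comm`; if `a` is central,
  the given non-central involution commutes with `a`;
* if `C(a) = ⟨a⟩`, normaliser growth gives `k ∉ ⟨a⟩` normalising `⟨a⟩`, acting by `a ↦ a⁻¹, a³` or `a⁵` (Rotman 5.45); the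
  half subgroup `⟨a⟩ ∪ ⟨a⟩k` (index `2`) upgrades the first two to an element acting by `a ↦ a⁵` (`exists_conj_eq_pow_five`),
  which is normalised to an involution `t` with `t a t⁻¹ = a⁵ = ac`; the involutions of `⟨a⟩ ∪ ⟨a⟩t` are `c, t, tc`.

## References

* [Rotman1995] J. J. Rotman, *An Introduction to the Theory of Groups*, 4th ed., GTM 148, Thm. 4.3 (normaliser growth),
  Cor. 5.45, Ch. 4 Ex. 4.4.
-/

namespace Summit.HodgeConjecture.CorCM.GaloisModels.CaseA

open Summit.HodgeConjecture.CorCM.GaloisModels.CyclicEight (exists_pow_mul_pow_of_comm)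
open Summit.HodgeConjecture.CorCM.GaloisModels.UniqueInvolution (conj_eq_or_of_orderOf_eq_two_pow)

variable {G : Type*} [Group G] [Finite G]

/-! ## §1 Tools -/

omit [Finite G] in
/-- `orderOf a = 8`: `aᵐ = aⁿ ↔ m ≡ n (mod 8)`. [folklore] -/
theorem pow_eq_pow_iff_mod {a : G} (ha : orderOf a = 8) (m n : ℕ) : a ^ m = a ^ n ↔ m % 8 = n % 8 := by
  rw [pow_inj_mod, ha]

/-- In a finite group an element of `⟨a⟩` is a natural power `aʳ` with `r < 8` (`orderOf a = 8`). [folklore] -/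
theorem exists_pow_eq_of_mem_zpowers {a x : G} (ha : orderOf a = 8) (hx : x ∈ Subgroup.zpowers a) :
    ∃ r : ℕ, r < 8 ∧ x = a ^ r := by
  obtain ⟨i, hi⟩ := (isOfFinOrder_of_finite a).mem_powers_iff_mem_zpowers.2 hx
  exact ⟨i % 8, Nat.mod_lt _ (by norm_num), by rw [← hi, ← ha, pow_mod_orderOf]⟩

omit [Finite G] in
/-- `x a x⁻¹ = aʳ` with `orderOf a = 8` and `a⁴ ≠ 1`-type bookkeeping: `r` is odd. [folklore] -/
theorem odd_of_conj_eq_pow {a x : G} (ha : orderOf a = 8) {r : ℕ} (h : x * a * x⁻¹ = a ^ r) : r % 2 = 1 := by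
  by_contra hr
  have hr' : r % 2 = 0 := by omega
  have ha8 : a ^ 8 = 1 := by rw [← ha]; exact pow_orderOf_eq_one a
  have h4 : (x * a * x⁻¹) ^ 4 = 1 := by
    rw [h, ← pow_mul, show r * 4 = 8 * (r / 2) by omega, pow_mul, ha8, one_pow]
  rw [conj_pow, mul_inv_eq_one, mul_eq_left] at h4
  have := orderOf_dvd_of_pow_eq_one h4
  rw [ha] at this; omega

omit [Finite G] in
/-- The four actions on `⟨a⟩ ≅ C₈`: `x a x⁻¹ = aʳ` ⟹ `x a x⁻¹ ∈ {a, a⁷, a⁵, a³}`. [cite: Rotman1995, Cor. 5.45] -/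
theorem conj_eq_pow_cases {a x : G} (ha : orderOf a = 8) {r : ℕ} (h : x * a * x⁻¹ = a ^ r) :
    x * a * x⁻¹ = a ∨ x * a * x⁻¹ = a ^ 7 ∨ x * a * x⁻¹ = a ^ 5 ∨ x * a * x⁻¹ = a ^ 3 := by
  have ha8 : a ^ 8 = 1 := by rw [← ha]; exact pow_orderOf_eq_one a
  have hodd := odd_of_conj_eq_pow ha h
  have hrr : a ^ (r * r) = a := by
    rw [← pow_one a, ← pow_mul, one_mul, pow_eq_pow_iff_mod ha]
    have : r % 8 = 1 ∨ r % 8 = 3 ∨ r % 8 = 5 ∨ r % 8 = 7 := by omega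
    rcases this with h | h | h | h <;> simp [Nat.mul_mod, h]
  have hinv : a⁻¹ = a ^ 7 := by
    rw [inv_eq_iff_mul_eq_one, ← pow_succ', ha8]
  rcases conj_eq_or_of_orderOf_eq_two_pow (m := 3) (by norm_num) (by rw [ha]; norm_num) h hrr with h1 | h1 | ⟨-, h1 | h1⟩
  · exact Or.inl h1
  · exact Or.inr (Or.inl (by rw [h1, hinv]))
  · right; right; left
    rw [h1, show (2 : ℕ) ^ (3 - 1) = 4 by norm_num, ← pow_succ']
  · right; right; right
    rw [h1, hinv, show (2 : ℕ) ^ (3 - 1) = 4 by norm_num, ← pow_add, show 7 + 4 = 8 + 3 from rfl, pow_add, ha8, one_mul]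

/-! ## §2 The finishing step: an involution commuting with `a` -/

/-- **Finish, commuting case.**  `c = a⁴` the only central involution; `t ∉ {1, c}` an involution commuting with `a`
(`orderOf a = 8`).  Then `t` is conjugate to `tc` and all its conjugates lie in `{t, tc}`. [cite: Rotman1995, Ch. 4 Ex. 4.4] -/
theorem two_conjugates_of_comm (hcard : Nat.card G = 32) {a t : G} (ha : orderOf a = 8)
    (huci : ∀ s : G, s * s = 1 → (∀ g : G, g * s = s * g) → s = 1 ∨ s = a ^ 4) (htt : t * t = 1) (ht1 : t ≠ 1)
    (ht4 : t ≠ a ^ 4) (hat : a * t = t * a) :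
    ∃ x : G, x * t * x⁻¹ = t * a ^ 4 ∧ ∀ g : G, g * t * g⁻¹ = t ∨ g * t * g⁻¹ = t * a ^ 4 := by
  have hconj := conj_involution_of_comm hcard ha htt ht1 ht4 hat
  have hnc : ∃ x : G, x * t ≠ t * x := by
    by_contra hall
    push Not at hall
    rcases huci t htt hall with h | h
    · exact ht1 h
    · exact ht4 h
  obtain ⟨x, hx⟩ := hnc
  refine ⟨x, ?_, hconj⟩
  rcases hconj x with h | h
  · exact absurd (mul_inv_eq_iff_eq_mul.1 h) hx
  · exact h

/-! ## §3 The case `C(a) = ⟨a⟩`: an element acting by `a ↦ a⁵` -/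

/-- From `k ∉ ⟨a⟩` normalising `⟨a⟩` with `k a k⁻¹ = a⁵` and `C(a) = ⟨a⟩`: an involution `t ∉ ⟨a⟩` with `t a t⁻¹ = a⁵`
(`k² = aʲ` with `j` even; `t = k a^{j/2}`). [cite: Rotman1995, Cor. 5.45] -/
theorem exists_involution_conj_eq_pow_five {a k : G} (ha : orderOf a = 8)
    (hC : ∀ m : G, m * a = a * m → m ∈ Subgroup.zpowers a) (hk : k ∉ Subgroup.zpowers a)
    (hka : k * a * k⁻¹ = a ^ 5) :
    ∃ t : G, t * t = 1 ∧ t ∉ Subgroup.zpowers a ∧ t * a * t⁻¹ = a ^ 5 := by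
  have ha8 : a ^ 8 = 1 := by rw [← ha]; exact pow_orderOf_eq_one a
  have hka' : k * a = a ^ 5 * k := by rw [← hka]; group
  -- `k²` commutes with `a`
  have hk2 : k * k * a = a * (k * k) := by
    have h25 : a ^ 25 = a := by
      rw [show (25 : ℕ) = 8 * 3 + 1 from rfl, pow_add, pow_mul, ha8, one_pow, one_mul, pow_one]
    calc k * k * a = k * (k * a) := mul_assoc _ _ _
      _ = k * (a ^ 5 * k) := by rw [hka']
      _ = (k * a ^ 5) * k := by group
      _ = (a ^ (5 * 5) * k) * k := by rw [semi_pow hka']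
      _ = a * (k * k) := by rw [show 5 * 5 = 25 from rfl, h25, mul_assoc]
  obtain ⟨j, hj8, hj⟩ := exists_pow_eq_of_mem_zpowers ha (hC _ hk2)
  -- `k` commutes with `k² = aʲ`: `a^{5j} = aʲ`, so `j` is even
  have hjev : j % 2 = 0 := by
    have h1 : k * a ^ j = a ^ j * k := by rw [← hj]; group
    rw [semi_pow hka'] at h1
    have h2 := mul_right_cancel h1
    rw [pow_eq_pow_iff_mod ha] at h2
    omega
  refine ⟨k * a ^ (j / 2), ?_, ?_, ?_⟩
  · -- `(k a^{j/2})² = a^{5 j/2 + j + j/2} = a^{4j} = 1`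
    calc k * a ^ (j / 2) * (k * a ^ (j / 2)) = k * a ^ (j / 2) * k * a ^ (j / 2) := by group
      _ = a ^ (5 * (j / 2)) * k * k * a ^ (j / 2) := by rw [semi_pow hka']
      _ = a ^ (5 * (j / 2)) * (k * k) * a ^ (j / 2) := by group
      _ = a ^ (5 * (j / 2) + j + j / 2) := by rw [hj, ← pow_add, ← pow_add]
      _ = 1 := by rw [show 5 * (j / 2) + j + j / 2 = 8 * (j / 2) by omega, pow_mul, ha8, one_pow]
  · intro hmem
    apply hk
    have : k = k * a ^ (j / 2) * (a ^ (j / 2))⁻¹ := by group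
    rw [this]
    exact Subgroup.mul_mem _ hmem (Subgroup.inv_mem _ (Subgroup.pow_mem _ (Subgroup.mem_zpowers a) _))
  · rw [show k * a ^ (j / 2) * a * (k * a ^ (j / 2))⁻¹ = k * (a ^ (j / 2) * a * (a ^ (j / 2))⁻¹) * k⁻¹ by group,
      ← pow_succ, pow_succ', mul_inv_cancel_right, hka]

/-- **Upgrade to `a ↦ a⁵`.**  `|G| = 32`, `C(a) = ⟨a⟩`, `k ∉ ⟨a⟩` with `k a k⁻¹ ∈ {a⁷, a³}`: some `k'` has `k' a k'⁻¹ = a⁵`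
(the half subgroup `⟨a⟩ ∪ ⟨a⟩k` has index `2` and no element of order `8` outside `⟨a⟩`; an element `g` outside it normalises
`⟨a⟩`, acting by `a⁵` itself or by the other of `a⁷, a³`, and then `g k` acts by `a⁵`). [cite: Rotman1995, Cor. 5.45 and Ch. 4 Ex. 4.4] -/
theorem exists_conj_eq_pow_five (hcard : Nat.card G = 32) {a k : G} (ha : orderOf a = 8)
    (hC : ∀ m : G, m * a = a * m → m ∈ Subgroup.zpowers a) (hk : k ∉ Subgroup.zpowers a) {μ : ℕ}
    (hμ : μ = 7 ∨ μ = 3) (hka : k * a * k⁻¹ = a ^ μ) : ∃ k' : G, k' * a * k'⁻¹ = a ^ 5 := by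
  classical
  have ha8 : a ^ 8 = 1 := by rw [← ha]; exact pow_orderOf_eq_one a
  have hka' : k * a = a ^ μ * k := by rw [← hka]; group
  -- `k²` commutes with `a`, hence `k² = aʲ`; `k` commutes with `aʲ` forces `4 ∣ j`
  have hk2 : k * k * a = a * (k * k) := by
    have hμμ : a ^ (μ * μ) = a := by
      rw [← pow_one a, ← pow_mul, one_mul, pow_eq_pow_iff_mod ha]
      rcases hμ with rfl | rfl <;> norm_num
    calc k * k * a = k * (k * a) := mul_assoc _ _ _
      _ = k * (a ^ μ * k) := by rw [hka']
      _ = (k * a ^ μ) * k := by group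
      _ = (a ^ (μ * μ) * k) * k := by rw [semi_pow hka']
      _ = a * (k * k) := by rw [hμμ, mul_assoc]
  obtain ⟨j, hj8, hj⟩ := exists_pow_eq_of_mem_zpowers ha (hC _ hk2)
  have hj4 : j % 4 = 0 := by
    have h1 : k * a ^ j = a ^ j * k := by rw [← hj]; group
    rw [semi_pow hka'] at h1
    have h2 := mul_right_cancel h1
    rw [pow_eq_pow_iff_mod ha] at h2
    rcases hμ with rfl | rfl <;> omega
  -- the half subgroup `⟨a⟩ ∪ ⟨a⟩k`
  obtain ⟨H, hidx, hmem⟩ := exists_half_subgroup hcard ha hk hka' hj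
  haveI hN := Subgroup.normal_of_index_eq_two hidx
  have haH : a ∈ H := (hmem a).2 ⟨1, 0, by omega, by simp⟩
  have hkH : k ∈ H := (hmem k).2 ⟨0, 1, by omega, by simp⟩
  have hHtop : H ≠ ⊤ := fun h => by
    rw [← Subgroup.index_eq_one, hidx] at h
    exact absurd h (by norm_num)
  obtain ⟨g, hg⟩ : ∃ g : G, g ∉ H := by
    by_contra hall
    push Not at hall
    exact hHtop (eq_top_iff.2 fun g _ => hall g)
  -- `g a g⁻¹ ∈ H` has order `8`, so it lies in `⟨a⟩`
  obtain ⟨i, l, hl, hil⟩ := (hmem _).1 (hN.conj_mem a haH g)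
  have hl0 : l = 0 := by
    by_contra hl1
    have hl1 : l = 1 := by omega
    subst hl1
    rw [pow_one] at hil
    -- `(aⁱ k)² = a^{(μ+1) i + j}` has fourth power... square in `⟨a⁴⟩`, so `(g a g⁻¹)⁴ = 1`
    have hsq : a ^ i * k * (a ^ i * k) = a ^ ((μ + 1) * i + j) := by
      calc a ^ i * k * (a ^ i * k) = a ^ i * (k * a ^ i) * k := by group
        _ = a ^ i * (a ^ (μ * i) * k) * k := by rw [semi_pow hka']
        _ = a ^ i * a ^ (μ * i) * (k * k) := by group
        _ = a ^ ((μ + 1) * i + j) := by rw [hj, ← pow_add, ← pow_add, Nat.succ_mul, Nat.add_comm (μ * i) i]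
    have h4 : (g * a * g⁻¹) ^ 4 = 1 := by
      rw [hil, show (4 : ℕ) = 2 * 2 from rfl, pow_mul, pow_two (a ^ i * k), hsq, ← pow_mul, pow_eq_one_iff_modEq, ha,
        Nat.ModEq]
      rcases hμ with rfl | rfl <;> omega
    rw [conj_pow, mul_inv_eq_one, mul_eq_left] at h4
    have := orderOf_dvd_of_pow_eq_one h4
    rw [ha] at this; omega
  subst hl0
  rw [pow_zero, mul_one] at hil
  -- same action as `k`: `k⁻¹ g ∈ C(a) = ⟨a⟩`, so `g ∈ H` — impossible
  have hsame : g * a * g⁻¹ = a ^ μ → False := by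
    intro h
    apply hg
    have hc : k⁻¹ * g * a = a * (k⁻¹ * g) := by
      have h1 : g * a = a ^ μ * g := by rw [← h]; group
      have h2 : k⁻¹ * a ^ μ = a * k⁻¹ := by rw [← hka]; group
      calc k⁻¹ * g * a = k⁻¹ * (g * a) := mul_assoc _ _ _
        _ = k⁻¹ * (a ^ μ * g) := by rw [h1]
        _ = (k⁻¹ * a ^ μ) * g := by group
        _ = a * (k⁻¹ * g) := by rw [h2, mul_assoc]
    rw [show g = k * (k⁻¹ * g) by group]
    exact H.mul_mem hkH (Subgroup.zpowers_le.2 haH (hC _ hc))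
  rcases conj_eq_pow_cases ha hil with h | h | h | h
  · -- `g` commutes with `a`: `g ∈ ⟨a⟩ ⊆ H`
    exfalso
    exact hg (Subgroup.zpowers_le.2 haH (hC g (mul_inv_eq_iff_eq_mul.1 h)))
  · rcases hμ with rfl | rfl
    · exact (hsame h).elim
    · -- `g` acts by `a⁷`, `k` by `a³`: `g k` acts by `a^{21} = a⁵`
      refine ⟨g * k, ?_⟩
      calc g * k * a * (g * k)⁻¹ = g * (k * a * k⁻¹) * g⁻¹ := by group
        _ = g * a ^ 3 * g⁻¹ := by rw [hka]
        _ = (g * a * g⁻¹) ^ 3 := by rw [conj_pow]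
        _ = a ^ 5 := by rw [h, ← pow_mul, pow_eq_pow_iff_mod ha]
  · exact ⟨g, h⟩
  · rcases hμ with rfl | rfl
    · refine ⟨g * k, ?_⟩
      calc g * k * a * (g * k)⁻¹ = g * (k * a * k⁻¹) * g⁻¹ := by group
        _ = g * a ^ 7 * g⁻¹ := by rw [hka]
        _ = (g * a * g⁻¹) ^ 7 := by rw [conj_pow]
        _ = a ^ 5 := by rw [h, ← pow_mul, pow_eq_pow_iff_mod ha]
    · exact (hsame h).elim

/-- **Finish, `a ↦ a⁵` case.**  `|G| = 32`, `c = a⁴` central, `t ∉ ⟨a⟩` an involution with `t a t⁻¹ = a⁵ = ac`: the half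
subgroup `⟨a⟩ ∪ ⟨a⟩t` is normal, its involutions are `c, t, tc`, so every conjugate of `t` is `t` or `tc`, and `a t a⁻¹ = tc`.
[cite: Rotman1995, Ch. 4 Ex. 4.4] -/
theorem two_conjugates_of_conj_eq_pow_five (hcard : Nat.card G = 32) {a t : G} (ha : orderOf a = 8)
    (hcen : ∀ g : G, a ^ 4 * g = g * a ^ 4) (htt : t * t = 1) (hta : t ∉ Subgroup.zpowers a)
    (htat : t * a * t⁻¹ = a ^ 5) :
    a * t * a⁻¹ = t * a ^ 4 ∧ ∀ g : G, g * t * g⁻¹ = t ∨ g * t * g⁻¹ = t * a ^ 4 := by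
  classical
  have ha8 : a ^ 8 = 1 := by rw [← ha]; exact pow_orderOf_eq_one a
  have hta' : t * a = a ^ 5 * t := by rw [← htat]; group
  have hat : a * t = t * a ^ 5 := by
    -- `t a⁵ = a^{25} t = a t`
    have h := semi_pow hta' 5
    rw [show 5 * 5 = 8 * 3 + 1 from rfl, pow_add, pow_mul, ha8, one_pow, one_mul, pow_one] at h
    exact h.symm
  refine ⟨by rw [hat, pow_succ, ← mul_assoc, mul_inv_cancel_right], fun g => ?_⟩
  obtain ⟨H, hidx, hmem⟩ := exists_half_subgroup hcard ha hta hta' (m := 0) (by rw [pow_zero]; exact htt)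
  haveI hN := Subgroup.normal_of_index_eq_two hidx
  have htH : t ∈ H := (hmem t).2 ⟨0, 1, by omega, by simp⟩
  obtain ⟨i, j, hj, hij⟩ := (hmem _).1 (hN.conj_mem t htH g)
  have hsq : (g * t * g⁻¹) * (g * t * g⁻¹) = 1 := by
    rw [show g * t * g⁻¹ * (g * t * g⁻¹) = g * (t * t) * g⁻¹ by group, htt]; group
  rcases (by omega : j = 0 ∨ j = 1) with rfl | rfl
  · -- `g t g⁻¹ = aⁱ` is an involution of `⟨a⟩`, i.e. `a⁴ = c`, central: then `t = c ∈ ⟨a⟩`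
    exfalso
    rw [pow_zero, mul_one] at hij
    rw [hij] at hsq
    rcases pow_eq_one_or_eq_pow_four ha hsq with h | h
    · rw [h, mul_inv_eq_one, mul_eq_left] at hij
      exact hta (hij ▸ Subgroup.one_mem _)
    · rw [h, mul_inv_eq_iff_eq_mul, hcen g] at hij
      have ht : t = a ^ 4 := mul_left_cancel hij
      exact hta (ht ▸ Subgroup.pow_mem _ (Subgroup.mem_zpowers a) 4)
  · rw [pow_one] at hij
    -- `(aⁱ t)² = a^{6i}`: `= 1` forces `4 ∣ i`
    have hsq' : a ^ (6 * i) = 1 := by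
      rw [hij] at hsq
      calc a ^ (6 * i) = a ^ i * a ^ (5 * i) * (t * t) := by rw [htt, mul_one, ← pow_add, show i + 5 * i = 6 * i by ring]
        _ = a ^ i * (a ^ (5 * i) * t) * t := by group
        _ = a ^ i * (t * a ^ i) * t := by rw [← semi_pow hta']
        _ = a ^ i * t * (a ^ i * t) := by group
        _ = 1 := hsq
    rw [pow_eq_one_iff_modEq, ha, Nat.ModEq] at hsq'
    have hi4 : i % 8 = 0 ∨ i % 8 = 4 := by omega
    rcases hi4 with h | h
    · left
      rw [hij, ← pow_mod_orderOf, ha, h, pow_zero, one_mul]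
    · right
      rw [hij, ← pow_mod_orderOf, ha, h]
      exact (show Commute (a ^ 4) t from hcen t).eq

/-! ## §4 The theorem -/

/-- **An involution with two conjugates (lemma SIZE2 of the order-`32` base, case A).**  `|G| = 32`; `c ≠ 1` central with
`c² = 1` and `c` the ONLY central involution; `g⁴ ∈ {1, c}` for every `g`; `a` of order `8`; some involution of `G` is not
central.  Then there is an involution `t ∉ {1, c}`, conjugate to `tc`, all of whose conjugates lie in `{t, tc}`.
[cite: Rotman1995, Thm. 4.3, Cor. 5.45 and Ch. 4 Ex. 4.4] -/
theorem exists_involution_two_conjugates (hcard : Nat.card G = 32) {c : G} (hc1 : c ≠ 1)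
    (hcen : ∀ g : G, c * g = g * c) (huci : ∀ s : G, s * s = 1 → (∀ g : G, g * s = s * g) → s = 1 ∨ s = c)
    (hp4 : ∀ g : G, g ^ 4 = 1 ∨ g ^ 4 = c) {a : G} (ha : orderOf a = 8)
    (hnci : ∃ u : G, u * u = 1 ∧ ∃ y : G, y * u ≠ u * y) :
    ∃ t x : G, t * t = 1 ∧ t ≠ 1 ∧ t ≠ c ∧ x * t * x⁻¹ = t * c ∧
      ∀ g : G, g * t * g⁻¹ = t ∨ g * t * g⁻¹ = t * c := by
  classical
  have ha8 : a ^ 8 = 1 := by rw [← ha]; exact pow_orderOf_eq_one a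
  have ha4 : a ^ 4 = c := by
    rcases hp4 a with h | h
    · have := orderOf_dvd_of_pow_eq_one h
      rw [ha] at this; omega
    · exact h
  subst ha4
  -- the finishing step from an involution `t ∉ {1, c}` commuting with `a`
  have finish : ∀ t : G, t * t = 1 → t ≠ 1 → t ≠ a ^ 4 → a * t = t * a →
      ∃ t x : G, t * t = 1 ∧ t ≠ 1 ∧ t ≠ a ^ 4 ∧ x * t * x⁻¹ = t * a ^ 4 ∧
        ∀ g : G, g * t * g⁻¹ = t ∨ g * t * g⁻¹ = t * a ^ 4 := by
    intro t htt ht1 ht4 hat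
    obtain ⟨x, hx, hall⟩ := two_conjugates_of_comm hcard ha huci htt ht1 ht4 hat
    exact ⟨t, x, htt, ht1, ht4, hx, hall⟩
  by_cases hZ : ∀ y : G, y * a = a * y
  · -- `a` central: the given non-central involution commutes with `a`
    obtain ⟨u, huu, y, hy⟩ := hnci
    refine finish u huu (fun h => hy (by rw [h]; group)) (fun h => hy (by rw [h, hcen y])) (hZ u).symm
  push Not at hZ
  obtain ⟨y, hy⟩ := hZ
  by_cases hC : ∀ m : G, m * a = a * m → m ∈ Subgroup.zpowers a
  · -- `C(a) = ⟨a⟩`: normaliser growth, then the `a ↦ a⁵` analysis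
    have hnc : NormalizerCondition G := by
      haveI : Fact (Nat.Prime 2) := ⟨Nat.prime_two⟩
      haveI := (IsPGroup.of_card (p := 2) (n := 5) (by rw [hcard]; norm_num) : IsPGroup 2 G).isNilpotent
      exact Group.normalizerCondition_of_isNilpotent
    have hlt : Subgroup.zpowers a < ⊤ := by
      rw [lt_top_iff_ne_top]
      intro h
      have := Nat.card_zpowers a
      rw [h, Subgroup.card_top, hcard, ha] at this
      norm_num at this
    have hlt' := hnc _ hlt
    obtain ⟨k, hkN, hk⟩ := SetLike.exists_of_lt hlt'
    have hka : k * a * k⁻¹ ∈ Subgroup.zpowers a :=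
      ((Subgroup.mem_normalizer_iff.1 hkN) a).1 (Subgroup.mem_zpowers a)
    obtain ⟨r, -, hr⟩ := exists_pow_eq_of_mem_zpowers ha hka
    -- an element acting by `a ↦ a⁵`
    have h5 : ∃ k' : G, k' * a * k'⁻¹ = a ^ 5 := by
      rcases conj_eq_pow_cases ha hr with h | h | h | h
      · exact absurd (hC k (mul_inv_eq_iff_eq_mul.1 h)) hk
      · exact exists_conj_eq_pow_five hcard ha hC hk (Or.inl rfl) h
      · exact ⟨k, h⟩
      · exact exists_conj_eq_pow_five hcard ha hC hk (Or.inr rfl) h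
    obtain ⟨k', hk'⟩ := h5
    have hk'mem : k' ∉ Subgroup.zpowers a := by
      intro hmem
      obtain ⟨s, -, hs⟩ := exists_pow_eq_of_mem_zpowers ha hmem
      rw [show k' * a * k'⁻¹ = a by rw [hs]; group] at hk'
      nth_rewrite 1 [← pow_one a] at hk'
      rw [pow_eq_pow_iff_mod ha] at hk'; norm_num at hk'
    obtain ⟨t, htt, hta, htat⟩ := exists_involution_conj_eq_pow_five ha hC hk'mem hk'
    obtain ⟨hx, hall⟩ := two_conjugates_of_conj_eq_pow_five hcard ha hcen htt hta htat
    exact ⟨t, a, htt, fun h => hta (h ▸ Subgroup.one_mem _),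
      fun h => hta (h ▸ Subgroup.pow_mem _ (Subgroup.mem_zpowers a) 4), hx, hall⟩
  · -- some `m ∉ ⟨a⟩` commutes with `a`: `C(a) = ⟨a⟩ × ⟨m⟩`, `m² = a^{2i'}`, `t = m a^{-i'}`
    push Not at hC
    obtain ⟨m, hma, hm⟩ := hC
    have hcomm : Commute m a := hma
    obtain ⟨i, j, hi8, hj2, hij⟩ := exists_pow_mul_pow_of_comm hcard ha hm hma.symm hy (m * m)
      (by rw [mul_assoc, hma, ← mul_assoc, hma, mul_assoc])
    have hj0 : j = 0 := by
      by_contra hj1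
      have hj1 : j = 1 := by omega
      subst hj1
      rw [pow_one] at hij
      have hmem : a ^ i ∈ Subgroup.zpowers a := Subgroup.pow_mem _ (Subgroup.mem_zpowers a) i
      rw [← mul_right_cancel hij] at hmem
      exact hm hmem
    subst hj0
    rw [pow_zero, mul_one] at hij
    -- `m⁴ = a^{2i} ∈ {1, a⁴}` forces `i` even
    have hiev : i % 2 = 0 := by
      have h4 : m ^ 4 = a ^ (i * 2) := by
        rw [show (4 : ℕ) = 2 * 2 from rfl, pow_mul m, pow_two m, hij, ← pow_mul]
      rcases hp4 m with h | h
      · rw [h4, pow_eq_one_iff_modEq, ha, Nat.ModEq] at h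
        omega
      · rw [h4, pow_eq_pow_iff_mod ha] at h
        omega
    have hmem_of : ∀ n : ℕ, m * a ^ n ∈ Subgroup.zpowers a → False := by
      intro n h
      apply hm
      have : m = m * a ^ n * (a ^ n)⁻¹ := by group
      rw [this]
      exact Subgroup.mul_mem _ h (Subgroup.inv_mem _ (Subgroup.pow_mem _ (Subgroup.mem_zpowers a) n))
    refine finish (m * a ^ (8 - i / 2)) ?_ (fun h => hmem_of _ (h ▸ Subgroup.one_mem _))
      (fun h => hmem_of _ (h ▸ Subgroup.pow_mem _ (Subgroup.mem_zpowers a) 4)) ?_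
    · calc m * a ^ (8 - i / 2) * (m * a ^ (8 - i / 2))
          = m * (a ^ (8 - i / 2) * m) * a ^ (8 - i / 2) := by group
        _ = m * (m * a ^ (8 - i / 2)) * a ^ (8 - i / 2) := by rw [(hcomm.pow_right _).eq]
        _ = (m * m) * a ^ (8 - i / 2 + (8 - i / 2)) := by rw [pow_add]; group
        _ = 1 := by
          rw [hij, ← pow_add, pow_eq_one_iff_modEq, ha, Nat.ModEq]
          omega
    · rw [← mul_assoc, ← hma, mul_assoc, ← pow_succ', pow_succ, mul_assoc]

end Summit.HodgeConjecture.CorCM.GaloisModels.CaseA
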